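import Summits.RiemannHypothesis.RiemannHypothesis.Theorems.LiDirichletTrendDefs
import Literature.NumberTheory.LFunctions.KeiperLiTrendDirichlet
import HarnessLib

/-!
# PART F′ (cell rh-li, engine seat rh-li-eng-5 gen 4) — T-D2 `LiDirichletTrend` PROVED (RH-FREE, GRH-FREE)

Ladder RH, row L-D (Dirichlet rows) → its PROOF-OF-DATA twin **T-D2**: the archimedean trend of the
Dirichlet Li coefficients typed in `LiDirichletTrendDefs.lean` (theory g7, from rh-li-eng-5's certified table
HOME/DATA.md § J (S2): 37 primitive characters `q ≤ 13` + `ζ`, `n ≤ 1000`) is now a kernel theorem: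

  `LiDirichletTrend : ∀ q ≥ 1, χ mod q, n ≥ 1, |charLiTrend χ n − ((n/2)(H_n − 1 − log(2π/q)) + (a−1)/2)| ≤ 2`.

The analysis is the Literature theorem `Literature.NumberTheory.LFunctions.abs_re_liTrendGen_sub_le`
(`KeiperLiTrendDirichlet.lean`, constant `1`; even characters: the `ζ` trend law of `KeiperLiTrend.lean` after
`𝒜_χ = 𝒜_ζ − L + ((log(q/π) + log π)/2)L²`; odd characters: Legendre duplication `ψ((L+1)/2) = 2ψ(L) − 2 log 2 − ψ(L/2)`,
Stirling for `ψ(L)` and Cauchy's estimate on the unit disc).  This file only instantiates it at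
`c = log(q/π)`, `a = charParity χ` and rewrites `log(2π/q) = log 2 − log(q/π)`.

**Nothing in this file bears on the truth of RH or GRH**: the trend is the Li functional of the Gamma factor of
`ξ(s, χ)` alone; no zero and no value of `L(s, χ)` enters; `Re λ_χ(n) ≥ 0 ∀ n` (`LiCriterionDirichlet.lean`) is
GRH(χ) itself (RH-EQUIVALENT) and is untouched.  bears_on: LADDER-RH L-D (COLUMN 4 LI) — books the certified
`lb_χ(n)` column of HOME/data/li_dirichlet_lambda_N1000.tsv against a theorem.
-/

noncomputable section

-- D-0017: `Summit.<S>.<S>.…` is the designed namespace of a single-problem summit.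
set_option linter.dupNamespace false

namespace Summit.RiemannHypothesis.RiemannHypothesis.Theorems.LiTheory

open Literature.NumberTheory.LFunctions

/-- **T-D2 `LiDirichletTrend` holds (RH-FREE, GRH-FREE PROOF-OF-DATA).**  Uniformly in the modulus `q ≥ 1`,
the character `χ mod q` and `n ≥ 1`:

  `| lb_χ(n) − ( (n/2)(H_n − 1 − log(2π/q)) + (a − 1)/2 ) | ≤ 2`,

`lb_χ(n) = charLiTrend χ n` the archimedean trend of `λ_χ(n)`, `a = charParity χ`.  (In fact `≤ 1`:
`Literature.NumberTheory.LFunctions.abs_re_liTrendGen_sub_le`; the data show `≤ 0.14`.)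
[cite: Lagarias2007LiCoefficients, (1.13)–(1.15); Voros2006, §4] -/
theorem liDirichletTrend_holds : LiDirichletTrend := by
  intro q inst χ n hn
  obtain ⟨m, rfl⟩ : ∃ m, n = m + 1 := ⟨n - 1, by omega⟩
  have hq0 : (q : ℝ) ≠ 0 := by exact_mod_cast inst.out
  have ha : charParity χ ≤ 1 := by
    unfold charParity; split_ifs <;> norm_num
  have key := abs_re_liTrendGen_sub_le (Real.log ((q : ℝ) / Real.pi)) ha m
  have hlog : Real.log (2 * Real.pi / q) = Real.log 2 - Real.log ((q : ℝ) / Real.pi) := by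
    rw [Real.log_div (by positivity) hq0, Real.log_mul two_ne_zero Real.pi_ne_zero,
      Real.log_div hq0 Real.pi_ne_zero]
    ring
  have e1 : charLiTrend χ (m + 1) =
      (iteratedDeriv m (fun z ↦ ((Real.log ((q : ℝ) / Real.pi) : ℂ) / 2 +
        Complex.digamma ((liMap z + (charParity χ : ℂ)) / 2) / 2) * liMap z ^ 2) 0 / (m.factorial : ℂ)).re := by
    simp only [charLiTrend, Nat.add_sub_cancel]
    rfl
  have e2 : charLiTrendMain χ (m + 1) =
      ((m + 1 : ℕ) : ℝ) / 2 * ((harmonic (m + 1) : ℝ) - 1 - Real.log 2 + Real.log ((q : ℝ) / Real.pi)) +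
        ((charParity χ : ℝ) - 1) / 2 := by
    simp only [charLiTrendMain, hlog]
    ring
  rw [e1, e2]
  exact key.trans (by norm_num)

end Summit.RiemannHypothesis.RiemannHypothesis.Theorems.LiTheory

end
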